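import Summits.NavierStokesRegularity.FunctionalMining.TopEigGapCutoffPowDensity
import Summits.NavierStokesRegularity.FunctionalMining.TopEigGapVelocity
import Summits.NavierStokesRegularity.FunctionalMining.TopEigGapCutoffEstimate
import HarnessLib

/-!
# FunctionalMining — L-λ(η) for `2 < q ≤ 6`, the cut-off estimate at fixed `δ > 0`:
# `Φ_q − 2δ∫λ₁^{q−1} ≤ (3(q−1)/(2η))^{1/2} (K Φ_q)^{1/2} ((2/q)T_q + 4δ∫λ₁^{q−2}‖S(Δv)‖)^{1/2}`

Search for candidate a priori estimates; no regularity claim. Cell `pub-nsfunc`, prove seat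
(gen 26). The `q > 2` companion of `TopEigGapCutoffEstimate` (there `q = 2`), toward the dictionary's
node `TopEigGapCoercivePos q η` (Proposition L-λ(η) for `2 ≤ q ≤ 6`, SIEVELD §3.4b (4)). With
`H = H_δ = cutPow δ q`, `M^δ_q = H(λ₁)P₁`, `F^δ_{q,k} = H(λ₁)∂ₖλ₁` (GLOBALLY smooth on the class,
`TopEigGapCutoffPowDeriv` / `TopEigGapCutoffPowDensity`) and the Danskin density `μ = μ(S;S(Δv))`:
1. HEAT SIDE: `T_q = −∫qλ₁^{q−1}μ` (Danskin, no simplicity); `∫ρ^δ_q = −2∫H(λ₁)μ` (`∫∂ₖF^δ_{q,k} = 0`),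
   `0 ≤ λ₁^{q−1} − H(λ₁) ≤ 2δλ₁^{q−2}` ⇒ `∫ρ^δ_q ≤ (2/q)T_q + 4δ∫λ₁^{q−2}‖S(Δv)‖`.
2. GRADIENT SIDE: `∑ₖᵢⱼ(∂ₖM^δ_qᵢⱼ)² ≤ ((q−1)/(2η)) λ₁^{q−2} ρ^δ_q` pointwise (`TopEigGapCutoffPowDensity`).
3. MOMENT SIDE through the VELOCITY (`TopEigGapVelocity`): `∑SᵢⱼM^δ_qᵢⱼ = H(λ₁)λ₁`,
   `∫S:M^δ_q = −∫∑ⱼuⱼ∑ᵢ∂ᵢM^δ_qᵢⱼ ≤ ∫‖u‖(3∑ᵢⱼ(∂ᵢMᵢⱼ)²)^{1/2} ≤ (3c₁)^{1/2}∫‖u‖λ₁^{(q−2)/2}(ρ^δ_q)^{1/2}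
   ≤ (3c₁)^{1/2}(∫‖u‖²λ₁^{q−2})^{1/2}(∫ρ^δ_q)^{1/2}` and the hypothesis `∫‖u‖²λ₁^{q−2} ≤ KΦ_q` (the
   Sobolev–Hölder brick `exists_integral_norm_sq_mul_topEig_rpow_le`, `2 < q ≤ 6`, zero mean).
4. `λ₁^q − 2δλ₁^{q−1} ≤ H(λ₁)λ₁`.
Result **`cut_topEigMoment_rpow_estimate`**. The limit `δ → 0` and the node are in `TopEigGapCoercivePow`.
[ours]
-/

noncomputable section

open Filter Topology Matrix Finset MeasureTheory
open scoped ContDiff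

namespace Summit.NavierStokesRegularity.FunctionalMining

open Literature.Analysis Literature.Analysis.FunctionSpaces Literature.Analysis.FunctionSpaces.Torus
  SharpClass.DirectorForm Literature.Analysis.Matrix

namespace TopEig

variable {v : UnitAddTorus (Fin 3) → EuclideanSpace ℝ (Fin 3)}

/-- **`∑ᵢⱼ Sᵢⱼ M^δ_qᵢⱼ = H_δ(λ₁) · λ₁`** at every point. [ours, bookkeeping] -/
theorem sum_strain_mul_cutProjPow (δ q : ℝ) (v : UnitAddTorus (Fin 3) → EuclideanSpace ℝ (Fin 3))
    (x : UnitAddTorus (Fin 3)) :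
    ∑ i, ∑ j, torusStrainMatrix v x i j * cutProjPow δ q v i j x =
      cutPow δ q (torusStrainTopEig v x) * torusStrainTopEig v x := by
  have h := sum_strain_mul_topProj v x
  calc ∑ i, ∑ j, torusStrainMatrix v x i j * cutProjPow δ q v i j x
      = cutPow δ q (torusStrainTopEig v x) * ∑ i, ∑ j, torusStrainMatrix v x i j * topProj v x i j := by
        rw [Finset.mul_sum]
        refine Finset.sum_congr rfl fun i _ => ?_
        rw [Finset.mul_sum]
        refine Finset.sum_congr rfl fun j _ => ?_
        unfold cutProjPow
        ring
    _ = cutPow δ q (torusStrainTopEig v x) * torusStrainTopEig v x := by rw [h]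

/-- `topProj` is symmetric, hence so is `M^δ_q`. [ours, bookkeeping] -/
theorem cutProjPow_symm (δ q : ℝ) (v : UnitAddTorus (Fin 3) → EuclideanSpace ℝ (Fin 3)) (i j : Fin 3)
    (x : UnitAddTorus (Fin 3)) : cutProjPow δ q v i j x = cutProjPow δ q v j i x := by
  simp only [cutProjPow, topProj, Matrix.vecMulVec_apply, mul_comm (topVec v x i)]

/-- For `s ≥ 0`, `q > 2`, `δ > 0`: `0 ≤ s^{q−1} − H_δ(s) ≤ 2δ s^{q−2}` (also at `s = 0`). [folklore] -/
theorem rpow_sub_cutPow_mem {δ q s : ℝ} (hδ : 0 < δ) (hq : 2 < q) (hs : 0 ≤ s) :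
    0 ≤ s ^ (q - 1) - cutPow δ q s ∧ s ^ (q - 1) - cutPow δ q s ≤ 2 * δ * s ^ (q - 2) := by
  rcases hs.eq_or_lt with h0 | hpos
  · rw [← h0, cutPow_of_le hδ hδ.le, Real.zero_rpow (by linarith), Real.zero_rpow (by linarith)]
    simp
  · exact ⟨rpow_sub_cutPow_nonneg q hpos, rpow_sub_cutPow_le q hδ hpos⟩

/-- **THE CUT-OFF ESTIMATE AT EXPONENT `q`.** For `v` smooth, divergence free and zero mean on `T³`,
`2 < q`, `0 < η ≤ 1`, `λ₂ ≤ (1−η)λ₁` everywhere, every `δ > 0`, and every `K ≥ 0` with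
`∫‖v‖²λ₁^{q−2} ≤ K·Φ_q(v)`:
`Φ_q − 2δ∫λ₁^{q−1} ≤ √(3(q−1)/(2η)) · √(K Φ_q) · √((2/q) T_q + 4δ ∫λ₁^{q−2}‖S(Δv)‖)`. [ours] -/
theorem cut_topEigMoment_rpow_estimate (hv : Torus.IsSmooth v) (hdiv : Torus.IsDivFree v)
    {q : ℝ} (hq : 2 < q) {η : ℝ} (hη0 : 0 < η) (hη1 : η ≤ 1)
    (hgap : ∀ x : UnitAddTorus (Fin 3), torusStrainMidEig v x ≤ (1 - η) * torusStrainTopEig v x)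
    {K : ℝ} (hK : ∫ x, ‖v x‖ ^ 2 * torusStrainTopEig v x ^ (q - 2) ≤ K * torusTopEigMoment q v)
    {δ : ℝ} (hδ : 0 < δ) :
    torusTopEigMoment q v - 2 * δ * ∫ x, torusStrainTopEig v x ^ (q - 1) ≤
      Real.sqrt (3 * ((q - 1) / (2 * η))) * Real.sqrt (K * torusTopEigMoment q v) *
        Real.sqrt (2 / q * heatDissipation (torusTopEigMoment q) v +
          4 * δ * ∫ x, torusStrainTopEig v x ^ (q - 2) * ‖StrainL4.strainFlat (Torus.laplacian v) x‖) := by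
  have hq1 : (1 : ℝ) ≤ q := by linarith
  have hq0 : 0 < q := by linarith
  have hq2 : 0 < q - 2 := by linarith
  -- smoothness of the cut-off fields
  have hMs : ∀ i j, Torus.IsSmooth (cutProjPow δ q v i j) := fun i j =>
    isSmooth_cutProjPow hv hdiv q hδ hη0 hgap i j
  have hFs : ∀ k, Torus.IsSmooth (cutFluxPow δ q v k) := fun k =>
    isSmooth_cutFluxPow hv hdiv q hδ hη0 hgap k
  have hl0 : ∀ x, 0 ≤ torusStrainTopEig v x := fun x => by
    rw [← lam_strainFlat]; exact lam_strainFlat_nonneg hv hdiv x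
  have hlc : Continuous (torusStrainTopEig v) := continuous_torusStrainTopEig hv
  have hLc : Continuous fun x => torusStrainTopEig v x ^ (q - 2) := hlc.rpow_const fun x => Or.inr hq2.le
  have hHc : Continuous fun x => cutPow δ q (torusStrainTopEig v x) :=
    ((continuous_cutRamp δ).comp hlc).mul hLc
  have hH0 : ∀ x, 0 ≤ cutPow δ q (torusStrainTopEig v x) := fun x => cutPow_nonneg q (hl0 x)
  -- (1) `Φ_q = ∫ λ₁^q`
  have hΦ : torusTopEigMoment q v = ∫ x, torusStrainTopEig v x ^ q := by
    rw [torusTopEigMoment_eq hv hdiv q]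
    exact integral_congr_ae (ae_of_all _ fun x => by show lam _ ^ q = _; rw [lam_strainFlat])
  have hF0 : 0 ≤ torusTopEigMoment q v := torusTopEigMoment_nonneg q v
  -- (2) HEAT SIDE
  set μ : UnitAddTorus (Fin 3) → ℝ := fun x =>
    dirTopEig (StrainL4.strainFlat v x) (StrainL4.strainFlat (Torus.laplacian v) x) with hμdef
  set C : ℝ := ∫ x, torusStrainTopEig v x ^ (q - 2) * ‖StrainL4.strainFlat (Torus.laplacian v) x‖ with hCdef
  set T : ℝ := heatDissipation (torusTopEigMoment q) v with hTdef
  have hT : T = -∫ x, q * torusStrainTopEig v x ^ (q - 1) * μ x := by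
    rw [hTdef, heatDissipation_topEigMoment_eq_integral hq1 hv hdiv]
  have hμm : AEStronglyMeasurable μ volume := by
    have h := aestronglyMeasurable_danskinDensity (q := 1) le_rfl hv hv.laplacian
    refine h.congr (ae_of_all _ fun x => ?_)
    dsimp only
    rw [show (1 : ℝ) - 1 = 0 by norm_num, Real.rpow_zero]
    ring
  have hμbd : ∀ x, |μ x| ≤ ‖StrainL4.strainFlat (Torus.laplacian v) x‖ := fun x =>
    abs_dirTopEig_le_norm _ _
  have hnc : Continuous fun x => ‖StrainL4.strainFlat (Torus.laplacian v) x‖ :=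
    (StrainL4.continuous_strainFlat hv.laplacian).norm
  have hLmu : Integrable (fun x => q * torusStrainTopEig v x ^ (q - 1) * μ x) volume :=
    integrable_danskinDensity hq1 hv hv.laplacian hdiv
  have hHμ : Integrable (fun x => cutPow δ q (torusStrainTopEig v x) * μ x) volume := by
    refine Integrable.mono' ((hHc.mul hnc).integrable_unitAddTorus) (hHc.aestronglyMeasurable.mul hμm)
      (ae_of_all _ fun x => ?_)
    rw [Real.norm_eq_abs, abs_mul, abs_of_nonneg (hH0 x)]
    exact mul_le_mul_of_nonneg_left (hμbd x) (hH0 x)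
  have hdivF : ∀ k, Integrable (fun x => Torus.partialDeriv k (cutFluxPow δ q v k) x) volume := fun k =>
    ((hFs k).partialDeriv k).integrable
  have hdivF0 : ∀ k, ∫ x, Torus.partialDeriv k (cutFluxPow δ q v k) x = 0 := fun k =>
    integral_partialDeriv_eq_zero_holds (d := Fin 3) (F := ℝ) (hFs k) k
  have hρint : Integrable (cutDensityPow δ q v) volume := by
    unfold cutDensityPow
    exact ((integrable_finsetSum _ fun k _ => hdivF k).sub hHμ).const_mul 2
  have hρeq : ∫ x, cutDensityPow δ q v x = -2 * ∫ x, cutPow δ q (torusStrainTopEig v x) * μ x := by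
    unfold cutDensityPow
    rw [integral_const_mul, integral_sub (integrable_finsetSum _ fun k _ => hdivF k) hHμ,
      integral_finsetSum _ fun k _ => hdivF k]
    simp only [hdivF0, Finset.sum_const_zero, zero_sub]
    ring
  have hρle : ∫ x, cutDensityPow δ q v x ≤ 2 / q * T + 4 * δ * C := by
    have hI : Integrable (fun x => 2 * (torusStrainTopEig v x ^ (q - 1) - cutPow δ q (torusStrainTopEig v x)) * μ x)
        volume := by
      refine ((hLmu.const_mul (2 / q)).sub (hHμ.const_mul 2)).congr (ae_of_all _ fun x => ?_)
      simp only [Pi.sub_apply]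
      have e : 2 / q * q = 2 := by field_simp
      linear_combination (torusStrainTopEig v x ^ (q - 1) * μ x) * e
    have hbound : ∀ x, 2 * (torusStrainTopEig v x ^ (q - 1) - cutPow δ q (torusStrainTopEig v x)) * μ x ≤
        4 * δ * (torusStrainTopEig v x ^ (q - 2) * ‖StrainL4.strainFlat (Torus.laplacian v) x‖) := by
      intro x
      obtain ⟨h1, h2⟩ := rpow_sub_cutPow_mem hδ hq (hl0 x)
      have h3 : μ x ≤ ‖StrainL4.strainFlat (Torus.laplacian v) x‖ := (le_abs_self _).trans (hμbd x)
      have h4 : 0 ≤ ‖StrainL4.strainFlat (Torus.laplacian v) x‖ := norm_nonneg _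
      have h5 : 0 ≤ torusStrainTopEig v x ^ (q - 2) := Real.rpow_nonneg (hl0 x) _
      nlinarith
    have hI2 : Integrable (fun x => 4 * δ * (torusStrainTopEig v x ^ (q - 2) *
        ‖StrainL4.strainFlat (Torus.laplacian v) x‖)) volume :=
      ((hLc.mul hnc).const_mul (4 * δ)).integrable_unitAddTorus
    have hle : ∫ x, 2 * (torusStrainTopEig v x ^ (q - 1) - cutPow δ q (torusStrainTopEig v x)) * μ x ≤
        ∫ x, 4 * δ * (torusStrainTopEig v x ^ (q - 2) * ‖StrainL4.strainFlat (Torus.laplacian v) x‖) :=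
      integral_mono hI hI2 hbound
    have e1 : ∫ x, 2 * (torusStrainTopEig v x ^ (q - 1) - cutPow δ q (torusStrainTopEig v x)) * μ x =
        2 / q * (∫ x, q * torusStrainTopEig v x ^ (q - 1) * μ x) -
          2 * ∫ x, cutPow δ q (torusStrainTopEig v x) * μ x := by
      rw [← integral_const_mul, ← integral_const_mul, ← integral_sub (hLmu.const_mul _) (hHμ.const_mul 2)]
      refine integral_congr_ae (ae_of_all _ fun x => ?_)
      dsimp only
      have e : 2 / q * q = 2 := by field_simp
      linear_combination (-(torusStrainTopEig v x ^ (q - 1) * μ x)) * e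
    have e2 : ∫ x, 4 * δ * (torusStrainTopEig v x ^ (q - 2) * ‖StrainL4.strainFlat (Torus.laplacian v) x‖) =
        4 * δ * C := by rw [integral_const_mul]
    rw [e1, e2] at hle
    rw [hρeq, hT]
    linarith
  have hρ0 : 0 ≤ ∫ x, cutDensityPow δ q v x :=
    integral_nonneg fun x => cutDensityPow_nonneg hv hdiv hq.le hδ hη0 hgap x
  -- (3) GRADIENT SIDE, pointwise
  set c₁ : ℝ := (q - 1) / (2 * η) with hc₁
  have hc₁0 : 0 ≤ c₁ := by positivity
  have hGle : ∀ x, ∑ k, ∑ i, ∑ j, (Torus.partialDeriv k (cutProjPow δ q v i j) x) ^ 2 ≤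
      c₁ * torusStrainTopEig v x ^ (q - 2) * cutDensityPow δ q v x := fun x =>
    sum_sq_partialDeriv_cutProjPow_le_cutDensityPow hv hdiv hq.le hδ hη0 hη1 hgap x
  -- (4) MOMENT SIDE through the velocity
  have hIBP : ∫ x, ∑ i, ∑ j, torusStrainMatrix v x i j * cutProjPow δ q v i j x =
      -∫ x, ∑ j, v x j * ∑ i, Torus.partialDeriv i (cutProjPow δ q v i j) x :=
    integral_sum_strain_mul_eq_neg hv (N := fun i j => cutProjPow δ q v i j) hMs
      (fun i j x => cutProjPow_symm δ q v i j x)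
  have hstep : ∫ x, cutPow δ q (torusStrainTopEig v x) * torusStrainTopEig v x =
      -∫ x, ∑ j, v x j * ∑ i, Torus.partialDeriv i (cutProjPow δ q v i j) x := by
    rw [← hIBP]
    exact integral_congr_ae (ae_of_all _ fun x => (sum_strain_mul_cutProjPow δ q v x).symm)
  -- pointwise: `|∑ⱼ vⱼ dⱼ| ≤ √(3c₁) ‖v‖ √(λ₁^{q−2}) √ρ`
  set ρ : UnitAddTorus (Fin 3) → ℝ := cutDensityPow δ q v with hρdef
  have hρx0 : ∀ x, 0 ≤ ρ x := fun x => cutDensityPow_nonneg hv hdiv hq.le hδ hη0 hgap x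
  have hpt : ∀ x, -(∑ j, v x j * ∑ i, Torus.partialDeriv i (cutProjPow δ q v i j) x) ≤
      Real.sqrt (3 * c₁) * ((‖v x‖ * Real.sqrt (torusStrainTopEig v x ^ (q - 2))) * Real.sqrt (ρ x)) := by
    intro x
    have h1 := abs_sum_mul_le_norm_mul_sqrt (v x) (fun j => ∑ i, Torus.partialDeriv i (cutProjPow δ q v i j) x)
    have h2 := sum_sq_sum_le_three_mul (fun i j => Torus.partialDeriv i (cutProjPow δ q v i j) x)
    have hdiag : ∑ i, ∑ j, (Torus.partialDeriv i (cutProjPow δ q v i j) x) ^ 2 ≤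
        ∑ k, ∑ i, ∑ j, (Torus.partialDeriv k (cutProjPow δ q v i j) x) ^ 2 := by
      refine Finset.sum_le_sum fun i _ => ?_
      exact Finset.single_le_sum (f := fun i' => ∑ j, (Torus.partialDeriv i (cutProjPow δ q v i' j) x) ^ 2)
        (fun i' _ => Finset.sum_nonneg fun j _ => sq_nonneg _) (Finset.mem_univ i)
    have h3 : ∑ i, ∑ j, (Torus.partialDeriv i (cutProjPow δ q v i j) x) ^ 2 ≤
        c₁ * torusStrainTopEig v x ^ (q - 2) * ρ x := hdiag.trans (hGle x)
    have h4 : ∑ j, (∑ i, Torus.partialDeriv i (cutProjPow δ q v i j) x) ^ 2 ≤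
        3 * c₁ * (torusStrainTopEig v x ^ (q - 2) * ρ x) :=
      calc ∑ j, (∑ i, Torus.partialDeriv i (cutProjPow δ q v i j) x) ^ 2
          ≤ 3 * ∑ i, ∑ j, (Torus.partialDeriv i (cutProjPow δ q v i j) x) ^ 2 := h2
        _ ≤ 3 * (c₁ * torusStrainTopEig v x ^ (q - 2) * ρ x) := by linarith
        _ = 3 * c₁ * (torusStrainTopEig v x ^ (q - 2) * ρ x) := by ring
    have h5 : Real.sqrt (∑ j, (∑ i, Torus.partialDeriv i (cutProjPow δ q v i j) x) ^ 2) ≤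
        Real.sqrt (3 * c₁) * (Real.sqrt (torusStrainTopEig v x ^ (q - 2)) * Real.sqrt (ρ x)) := by
      rw [← Real.sqrt_mul (Real.rpow_nonneg (hl0 x) _), ← Real.sqrt_mul (by positivity)]
      exact Real.sqrt_le_sqrt h4
    have h6 := (neg_le_abs _).trans (h1.trans (mul_le_mul_of_nonneg_left h5 (norm_nonneg _)))
    calc -(∑ j, v x j * ∑ i, Torus.partialDeriv i (cutProjPow δ q v i j) x)
        ≤ ‖v x‖ * (Real.sqrt (3 * c₁) * (Real.sqrt (torusStrainTopEig v x ^ (q - 2)) * Real.sqrt (ρ x))) := h6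
      _ = Real.sqrt (3 * c₁) * ((‖v x‖ * Real.sqrt (torusStrainTopEig v x ^ (q - 2))) * Real.sqrt (ρ x)) := by
          ring
  -- integrate and Cauchy–Schwarz
  have hfc : Continuous fun x => ‖v x‖ * Real.sqrt (torusStrainTopEig v x ^ (q - 2)) :=
    hv.continuous.norm.mul hLc.sqrt
  have hInt1 : Integrable (fun x => ∑ j, v x j * ∑ i, Torus.partialDeriv i (cutProjPow δ q v i j) x) volume :=
    (continuous_finsetSum _ fun j _ => ((hv.apply j).continuous.mul
      (continuous_finsetSum _ fun i _ => ((hMs i j).partialDeriv i).continuous))).integrable_unitAddTorus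
  -- the `L²` data: `f = ‖v‖ √(λ₁^{q−2})`, `g = √ρ`
  set f : UnitAddTorus (Fin 3) → ℝ := fun x => ‖v x‖ * Real.sqrt (torusStrainTopEig v x ^ (q - 2)) with hfdef
  set g : UnitAddTorus (Fin 3) → ℝ := fun x => Real.sqrt (ρ x) with hgdef
  have hf0 : ∀ x, 0 ≤ f x := fun x => mul_nonneg (norm_nonneg _) (Real.sqrt_nonneg _)
  have hg0 : ∀ x, 0 ≤ g x := fun x => Real.sqrt_nonneg _
  have hf2 : ∀ x, f x ^ 2 = ‖v x‖ ^ 2 * torusStrainTopEig v x ^ (q - 2) := fun x => by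
    simp only [hfdef]; rw [mul_pow, Real.sq_sqrt (Real.rpow_nonneg (hl0 x) _)]
  have hg2 : ∀ x, g x ^ 2 = ρ x := fun x => Real.sq_sqrt (hρx0 x)
  have hgm : AEStronglyMeasurable g volume := Real.continuous_sqrt.comp_aestronglyMeasurable hρint.aestronglyMeasurable
  have hf2int : Integrable (fun x => f x ^ 2) volume := (hfc.pow 2).integrable_unitAddTorus
  have hfgint : Integrable (fun x => f x * g x) volume := by
    refine Integrable.mono' (((hf2int.add hρint).div_const 2)) (hfc.aestronglyMeasurable.mul hgm)
      (ae_of_all _ fun x => ?_)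
    rw [Real.norm_eq_abs, abs_mul, abs_of_nonneg (hf0 x), abs_of_nonneg (hg0 x)]
    have := two_mul_le_add_sq (f x) (g x)
    rw [hg2 x] at this
    simp only [Pi.add_apply]
    linarith
  -- `∫ H λ₁ ≤ √(3c₁) ∫ f g`
  have hM1 : ∫ x, cutPow δ q (torusStrainTopEig v x) * torusStrainTopEig v x ≤
      Real.sqrt (3 * c₁) * ∫ x, f x * g x := by
    rw [hstep, ← integral_neg, ← integral_const_mul]
    exact integral_mono hInt1.neg (hfgint.const_mul _) hpt
  -- Cauchy–Schwarz `∫ f g ≤ √(∫f²) √(∫g²)`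
  have hfL : MemLp f (ENNReal.ofReal 2) volume := hfc.memLp_of_hasCompactSupport (HasCompactSupport.of_compactSpace _)
  have hgL : MemLp g (ENNReal.ofReal 2) volume := by
    rw [show ENNReal.ofReal 2 = 2 by norm_num]
    exact (memLp_two_iff_integrable_sq hgm).2 (hρint.congr (ae_of_all _ fun x => (hg2 x).symm))
  have hCS := integral_mul_le_Lp_mul_Lq_of_nonneg (μ := volume) Real.HolderConjugate.two_two
    (ae_of_all _ hf0) (ae_of_all _ hg0) hfL hgL
  have eF : ∫ x, f x ^ (2 : ℝ) = ∫ x, ‖v x‖ ^ 2 * torusStrainTopEig v x ^ (q - 2) :=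
    integral_congr_ae (ae_of_all _ fun x => by dsimp only; rw [Real.rpow_two, hf2 x])
  have eG : ∫ x, g x ^ (2 : ℝ) = ∫ x, ρ x :=
    integral_congr_ae (ae_of_all _ fun x => by dsimp only; rw [Real.rpow_two, hg2 x])
  rw [eF, eG, ← Real.sqrt_eq_rpow, ← Real.sqrt_eq_rpow] at hCS
  -- monotone bounds under the square roots
  have hs1 : Real.sqrt (∫ x, ‖v x‖ ^ 2 * torusStrainTopEig v x ^ (q - 2)) ≤
      Real.sqrt (K * torusTopEigMoment q v) := Real.sqrt_le_sqrt hK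
  have hs2 : Real.sqrt (∫ x, ρ x) ≤ Real.sqrt (2 / q * T + 4 * δ * C) := Real.sqrt_le_sqrt hρle
  have hfg0 : 0 ≤ ∫ x, f x * g x := integral_nonneg fun x => mul_nonneg (hf0 x) (hg0 x)
  have hM2 : ∫ x, f x * g x ≤ Real.sqrt (K * torusTopEigMoment q v) * Real.sqrt (2 / q * T + 4 * δ * C) :=
    hCS.trans (mul_le_mul hs1 hs2 (Real.sqrt_nonneg _) (Real.sqrt_nonneg _))
  -- (5) lower bound `Φ_q − 2δ∫λ₁^{q−1} ≤ ∫ H λ₁`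
  have hlow : torusTopEigMoment q v - 2 * δ * ∫ x, torusStrainTopEig v x ^ (q - 1) ≤
      ∫ x, cutPow δ q (torusStrainTopEig v x) * torusStrainTopEig v x := by
    have hq1c : Continuous fun x => torusStrainTopEig v x ^ (q - 1) := hlc.rpow_const fun x => Or.inr (by linarith)
    have hqc : Continuous fun x => torusStrainTopEig v x ^ q := hlc.rpow_const fun x => Or.inr hq0.le
    have hI5 : Integrable (fun x => torusStrainTopEig v x ^ q) volume := hqc.integrable_unitAddTorus
    have hI6 : Integrable (fun x => 2 * δ * torusStrainTopEig v x ^ (q - 1)) volume :=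
      (hq1c.const_mul _).integrable_unitAddTorus
    have hI4 : Integrable (fun x => cutPow δ q (torusStrainTopEig v x) * torusStrainTopEig v x) volume :=
      (hHc.mul hlc).integrable_unitAddTorus
    have hpt' : ∀ x, torusStrainTopEig v x ^ q - 2 * δ * torusStrainTopEig v x ^ (q - 1) ≤
        cutPow δ q (torusStrainTopEig v x) * torusStrainTopEig v x := by
      intro x
      obtain ⟨-, h2⟩ := rpow_sub_cutPow_mem hδ hq (hl0 x)
      have hl := hl0 x
      have e1 : torusStrainTopEig v x ^ q = torusStrainTopEig v x * torusStrainTopEig v x ^ (q - 1) := by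
        rw [show q = 1 + (q - 1) by ring, Real.rpow_add' hl (by linarith), Real.rpow_one]
        ring_nf
      have e2 : torusStrainTopEig v x ^ (q - 1) = torusStrainTopEig v x * torusStrainTopEig v x ^ (q - 2) := by
        rw [show q - 1 = 1 + (q - 2) by ring, Real.rpow_add' hl (by linarith), Real.rpow_one]
      have h3 := mul_le_mul_of_nonneg_left h2 hl
      rw [e1]
      nlinarith
    have hI56 : Integrable (fun x => torusStrainTopEig v x ^ q - 2 * δ * torusStrainTopEig v x ^ (q - 1)) volume :=
      hI5.sub hI6
    have hle := integral_mono hI56 hI4 hpt'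
    rw [integral_sub hI5 hI6, integral_const_mul, ← hΦ] at hle
    exact hle
  -- (6) assemble
  have hsc : 0 ≤ Real.sqrt (3 * c₁) := Real.sqrt_nonneg _
  calc torusTopEigMoment q v - 2 * δ * ∫ x, torusStrainTopEig v x ^ (q - 1)
      ≤ ∫ x, cutPow δ q (torusStrainTopEig v x) * torusStrainTopEig v x := hlow
    _ ≤ Real.sqrt (3 * c₁) * ∫ x, f x * g x := hM1
    _ ≤ Real.sqrt (3 * c₁) * (Real.sqrt (K * torusTopEigMoment q v) * Real.sqrt (2 / q * T + 4 * δ * C)) :=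
        mul_le_mul_of_nonneg_left hM2 hsc
    _ = Real.sqrt (3 * ((q - 1) / (2 * η))) * Real.sqrt (K * torusTopEigMoment q v) *
        Real.sqrt (2 / q * T + 4 * δ * C) := by rw [hc₁]; ring

end TopEig

end Summit.NavierStokesRegularity.FunctionalMining

end
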